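import Summits.ValiantsHypothesis.ValiantsHypothesis.Theorems.DivisionGapPerDivisionHardStubOrderedCut

/-!
# Crux `DivisionGap.PerDivisionHard` (stmt-ValiantsHypothesis-5065), line `pair-descent-jss-endpoint` —
stub `stub_exposedOfIsolated`: lexicographic isolation is exposure by lexicographic prices
(EXPOSED-POINT rung)

`stub_exposedOfIsolated`: if `ms` is the strict lexicographic minimum of a finite set `S` of
exponent vectors along an injective list of cells `e 0, e 1, …, e (t-1)` (every other element of
`S` agrees with `ms` on the cells `e j`, `j < i`, and is strictly bigger at `e i`, for some `i`),
then there are prices `p : cells → ℕ` for which `ms` is the UNIQUE minimiser over `S` of the priced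
sum `Σ_{f ∈ range e} p f · m f`.

Proof.  Take an injective ranking `ρ` of the cells giving `e 0, e 1, …` the top ranks, in this
order (`exists_ranking`), a base `B` exceeding every exponent of every element of `S`
(`B = 1 + max_{m ∈ S} deg m`), and the lexicographic prices `p f = B ^ ρ f`.  For `m' ∈ S`,
`m' ≠ ms`, with `i` as in the hypothesis, the cells of `range e` ranked above `e i` are exactly the
`e j`, `j < i`, where `m'` and `ms` agree, and `ms (e i) < m' (e i)`; base-`B` domination
(`sum_mul_pow_lt_of_lex`: the cells ranked below `e i` contribute `< B ^ ρ (e i)` in total) gives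
`Σ p f · ms f < Σ p f · m' f`.
-/

noncomputable section

-- `Summit.ValiantsHypothesis.ValiantsHypothesis.…` is the tree's mandated single-conjunct layout
-- (Sub = Summit), so the duplicated namespace component is intended.
set_option linter.dupNamespace false

namespace Summit.ValiantsHypothesis.ValiantsHypothesis.Theorems.DivisionGapPerDivisionHard

/-- **`stub_exposedOfIsolated`** (lexicographic isolation is exposure by lexicographic prices).
If `ms ∈ S` is strictly lexicographically smaller along the injective list of cells `e` than every
other element of the finite set `S` of exponent vectors (every `m' ∈ S`, `m' ≠ ms`, agrees with
`ms` on `e j`, `j < i`, and `ms (e i) < m' (e i)` for some `i`), then there are prices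
`p : cells → ℕ` such that the priced sum `Σ_{f ∈ range e} p f · m f` over `m ∈ S` is uniquely
minimised at `ms`: the lexicographic prices `p f = B ^ ρ f` for an injective ranking `ρ` giving
`e 0, e 1, …` the top ranks (`exists_ranking`) and a base `B` exceeding all exponents of elements
of `S`, by base-`B` domination (`sum_mul_pow_lt_of_lex`). [folklore] -/
theorem stub_exposedOfIsolated :
    ∀ (n t : ℕ) (e : Fin t → Fin n × Fin n) (S : Finset ((Fin n × Fin n) →₀ ℕ)) (ms : (Fin n × Fin n) →₀ ℕ),
      Function.Injective e → ms ∈ S →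
      (∀ m' ∈ S, m' ≠ ms → ∃ i : Fin t, (∀ j : Fin t, j < i → m' (e j) = ms (e j)) ∧ ms (e i) < m' (e i)) →
      ∃ p : Fin n × Fin n → ℕ, ∀ m' ∈ S, m' ≠ ms →
        ∑ f ∈ Finset.univ.image e, p f * ms f < ∑ f ∈ Finset.univ.image e, p f * m' f := by
  intro n t e S ms he hms hlex
  -- an injective ranking of the cells giving `e 0, e 1, …` the top ranks, in this order
  obtain ⟨ρ, K, hρ, hρe, -⟩ := exists_ranking e he
  -- a base `B` exceeding every exponent of every element of `S`
  obtain ⟨B, hB⟩ : ∃ B : ℕ, ∀ m ∈ S, ∀ f, m f < B :=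
    ⟨S.sup (fun m => m.degree) + 1, fun m hm f => Nat.lt_succ_of_le
      ((Finsupp.le_degree f m).trans (Finset.le_sup (f := fun m => m.degree) hm))⟩
  -- the lexicographic prices
  refine ⟨fun f => B ^ ρ f, fun m' hm' hne => ?_⟩
  obtain ⟨i, hagree, hi⟩ := hlex m' hm' hne
  -- the cells of `range e` ranked above `e i` are exactly the `e j`, `j < i`
  have hhi : ∀ f ∈ Finset.univ.image e, ρ (e i) < ρ f → m' f = ms f := fun f hf hlt => by
    obtain ⟨j, -, rfl⟩ := Finset.mem_image.mp hf
    refine hagree j (Fin.lt_def.mpr ?_)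
    rw [hρe, hρe] at hlt
    have := j.2
    omega
  calc ∑ f ∈ Finset.univ.image e, B ^ ρ f * ms f
        = ∑ f ∈ Finset.univ.image e, ms f * B ^ ρ f :=
          Finset.sum_congr rfl fun f _ => mul_comm _ _
    _ < ∑ f ∈ Finset.univ.image e, m' f * B ^ ρ f :=
          sum_mul_pow_lt_of_lex (Finset.univ.image e) hρ
            (Finset.mem_image_of_mem e (Finset.mem_univ i)) (fun f _ => hB ms hms f) hi hhi
    _ = ∑ f ∈ Finset.univ.image e, B ^ ρ f * m' f :=
          Finset.sum_congr rfl fun f _ => mul_comm _ _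

end Summit.ValiantsHypothesis.ValiantsHypothesis.Theorems.DivisionGapPerDivisionHard

end
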